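import Literature.MathematicalPhysics.QuantumLattice.HubbardOneParticleCost
import Literature.MathematicalPhysics.QuantumLattice.HubbardTorus2DTiling
import Literature.MathematicalPhysics.QuantumLattice.FinDimSpectrumSectorGibbsLimit
import Summits.HubbardSuperconductivity.HubbardSuperconductivity.Theorems.NoGoNogoThesis

/-!
# Route `CooperPairDMottWalk`, crux `CooperPairDMott` (stmt-HubbardSuperconductivity-1177):
# the breathing Hamiltonian — Hermiticity, sectors, sector ground states, hopping bounds

Support file for the stub `stub_pairTrialCeiling`. The breathing family is a sum of two Hubbard
Hamiltonians on the same site set, `H = hamiltonian G₁ a U + hamiltonian G₂ b 0` (intra-plaquette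
graph `G₁`, inter-plaquette graph `G₂`). This file records, for arbitrary graphs `G₁, G₂` on a
finite linearly ordered site set: `H` is Hermitian and conserves `(N↑, N↓)`
(`breathing_isHermitian`, `breathing_preservesSectors`); every Hermitian sector-preserving matrix
has a ground state in each joint sector `(N, S^z) = (2n, 0)`, `n ≤ |Λ|`, whose energy bounds the
sector Rayleigh quotients from below (`szSector_groundState_of_preservesSectors`, the tree's
`sector_groundState` on the coordinate subspace `szSector (2n) 0`); the pure hopping term rescales,
`hamiltonian G b 0 = b • hamiltonian G 1 0` (`hamiltonian_zero_interaction`); and the hopping form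
is bounded by the number of ordered bonds, `|Re⟨ψ, hamiltonian G t 0 ψ⟩| ≤ 2|t| P ‖ψ‖²`
(`abs_re_hopping_le`), with `P ≤ Δ |Λ|` on a graph of degree `≤ Δ` and degrees/bond counts
monotone in the graph (`card_adjPairs_le`, `degree_le_of_le`).

References: E. H. Lieb, PRL 62 (1989) 1201 (sectors); H. Tasaki (2020) §2.2 (variational
principle); D. Ruelle, *Statistical Mechanics* (1969) §2.2 (bond counting). All statements are
[folklore]; no definition is introduced.
-/

set_option linter.dupNamespace false

noncomputable section

namespace Summit.HubbardSuperconductivity.HubbardSuperconductivity.Theorems.CooperPairDMottWalk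

open Matrix Finset Literature.MathematicalPhysics.QuantumLattice
open scoped ComplexOrder

variable {Λ : Type*} [LinearOrder Λ] [Fintype Λ]

/-! ### Hermiticity and sectors of a sum of two Hubbard Hamiltonians -/

/-- `hamiltonian G₁ a U + hamiltonian G₂ b 0` is Hermitian. [folklore] -/
theorem breathing_isHermitian (G₁ G₂ : SimpleGraph Λ) [DecidableRel G₁.Adj] [DecidableRel G₂.Adj]
    (a b U : ℝ) : (hamiltonian G₁ a U + hamiltonian G₂ b 0).IsHermitian :=
  (LiebThm1.hamiltonian_isHermitian G₁ a U).add (LiebThm1.hamiltonian_isHermitian G₂ b 0)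

/-- `hamiltonian G₁ a U + hamiltonian G₂ b 0` conserves `N↑` and `N↓`. [folklore] -/
theorem breathing_preservesSectors (G₁ G₂ : SimpleGraph Λ) [DecidableRel G₁.Adj] [DecidableRel G₂.Adj]
    (a b U : ℝ) : PreservesSectors (hamiltonian G₁ a U + hamiltonian G₂ b 0) :=
  (LiebThm1.preservesSectors_hamiltonian G₁ a U).add (LiebThm1.preservesSectors_hamiltonian G₂ b 0)

/-- **Pure hopping rescales**: `hamiltonian G b 0 = b • hamiltonian G 1 0`. [folklore] -/
theorem hamiltonian_zero_interaction (G : SimpleGraph Λ) [DecidableRel G.Adj] (b : ℝ) :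
    hamiltonian G b 0 = (b : ℂ) • hamiltonian G 1 0 := by
  unfold hamiltonian
  rw [Complex.ofReal_zero, zero_smul, add_zero, add_zero, Complex.ofReal_one, smul_smul, mul_neg,
    mul_one]

/-! ### Sector ground states of a sector-preserving Hermitian matrix -/

/-- **Ground states exist in the joint sectors `(2n, 0)`** for every Hermitian matrix conserving
`(N↑, N↓)` (`n ≤ |Λ|`), and the sector energy bounds every unit Rayleigh quotient of the sector from
below (`sector_groundState` on the coordinate subspace `szSector (2n) 0`, non-empty since `n ≤ |Λ|`).
Lieb, PRL 62 (1989) 1201, proof of Thm 1; Tasaki (2020) §2.2. [folklore] -/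
theorem szSector_groundState_of_preservesSectors (A : Matrix (Finset (Orb Λ)) (Finset (Orb Λ)) ℂ)
    (hA : A.IsHermitian) (hPS : PreservesSectors A) {n : ℕ} (hn : n ≤ Fintype.card Λ) :
    (∃ ψ, IsGroundStateInSector A (2 * n) 0 ψ) ∧
      ∀ v ∈ szSector (Λ := Λ) (2 * n) 0, star v ⬝ᵥ v = 1 →
        A.minEnergyOn (szSector (2 * n) 0) ≤ (star v ⬝ᵥ A *ᵥ v).re := by
  classical
  obtain ⟨α₀, -, hα₀⟩ : ∃ α₀ : Finset Λ, α₀ ⊆ Finset.univ ∧ α₀.card = n :=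
    Finset.exists_subset_card_eq (by rwa [Finset.card_univ])
  have hp : ∃ s : Finset (Orb Λ), (upPart s).card = n ∧ (downPart s).card = n :=
    ⟨pairSet α₀ α₀, by rw [upPart_pairSet, hα₀], by rw [downPart_pairSet, hα₀]⟩
  have hinv : ∀ s s' : Finset (Orb Λ), ¬((upPart s).card = n ∧ (downPart s).card = n) →
      ((upPart s').card = n ∧ (downPart s').card = n) → A s s' = 0 := by
    intro s s' hs hs'
    by_contra h
    have := hPS s s' h
    exact hs ⟨this.1.trans hs'.1, this.2.trans hs'.2⟩
  have hK : ∀ v : Fock (Orb Λ), v ∈ szSector (2 * n) (0 : ℝ) ↔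
      ∀ s, ¬((upPart s).card = n ∧ (downPart s).card = n) → v s = 0 :=
    fun v => mem_szSector_two_mul_zero_iff n v
  obtain ⟨⟨v, hv, hv0, hAv⟩, hb⟩ := sector_groundState A hA
    (fun s => (upPart s).card = n ∧ (downPart s).card = n) hp hinv (szSector (2 * n) 0) hK
  exact ⟨⟨v, hv, hv0, hAv⟩, hb⟩

/-- A normalised ground state exists in the joint sector `(2n, 0)`, `n ≤ |Λ|`. [folklore] -/
theorem exists_unit_groundStateInSector_of_preservesSectors (A : Matrix (Finset (Orb Λ)) (Finset (Orb Λ)) ℂ)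
    (hA : A.IsHermitian) (hPS : PreservesSectors A) {n : ℕ} (hn : n ≤ Fintype.card Λ) :
    ∃ ψ, star ψ ⬝ᵥ ψ = 1 ∧ IsGroundStateInSector A (2 * n) 0 ψ := by
  obtain ⟨⟨φ, hφ⟩, -⟩ := szSector_groundState_of_preservesSectors A hA hPS hn
  obtain ⟨c, hc0, hc1⟩ := exists_smul_unit hφ.2.1
  exact ⟨c • φ, hc1, Submodule.smul_mem _ c hφ.1, smul_ne_zero hc0 hφ.2.1,
    by rw [mulVec_smul, hφ.2.2, smul_comm]⟩

/-- **The homogeneous variational bound** in the joint sector `(2n, 0)`: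
`minEnergyOn A (szSector (2n) 0) · ‖φ‖² ≤ Re⟨φ, A φ⟩` for every `φ` of the sector. [folklore] -/
theorem minEnergyOn_szSector_mul_le (A : Matrix (Finset (Orb Λ)) (Finset (Orb Λ)) ℂ)
    (hA : A.IsHermitian) {n : ℕ} {φ : Fock (Orb Λ)} (hφ : φ ∈ szSector (Λ := Λ) (2 * n) 0) :
    A.minEnergyOn (szSector (2 * n) 0) * (star φ ⬝ᵥ φ).re ≤ (star φ ⬝ᵥ A *ᵥ φ).re := by
  by_cases h0 : φ = 0
  · subst h0
    simp
  obtain ⟨c, hc0, hc1⟩ := exists_smul_unit h0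
  have hmem : c • φ ∈ szSector (Λ := Λ) (2 * n) (0 : ℝ) := Submodule.smul_mem _ c hφ
  have h2 := minEnergyOn_le_rayleigh_of_mem hA _ hmem hc1
  have hcc : star c * c = ((‖c‖ ^ 2 : ℝ) : ℂ) := by
    rw [Complex.star_def, Complex.conj_mul']
    push_cast
    rfl
  rw [mulVec_smul, star_smul, smul_dotProduct, dotProduct_smul, smul_smul, hcc, smul_eq_mul,
    Complex.re_ofReal_mul] at h2
  rw [star_smul, smul_dotProduct, dotProduct_smul, smul_smul, hcc, smul_eq_mul] at hc1
  have h1 : ‖c‖ ^ 2 * (star φ ⬝ᵥ φ).re = 1 := by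
    have := congrArg Complex.re hc1
    rwa [Complex.re_ofReal_mul, Complex.one_re] at this
  have hpos : 0 < ‖c‖ ^ 2 := by
    have : c ≠ 0 := hc0
    positivity
  have key : ‖c‖ ^ 2 * (A.minEnergyOn (szSector (2 * n) 0) * (star φ ⬝ᵥ φ).re) ≤
      ‖c‖ ^ 2 * (star φ ⬝ᵥ A *ᵥ φ).re :=
    calc ‖c‖ ^ 2 * (A.minEnergyOn (szSector (2 * n) 0) * (star φ ⬝ᵥ φ).re)
        = A.minEnergyOn (szSector (2 * n) 0) * (‖c‖ ^ 2 * (star φ ⬝ᵥ φ).re) := by ring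
      _ = A.minEnergyOn (szSector (2 * n) 0) := by rw [h1, mul_one]
      _ ≤ ‖c‖ ^ 2 * (star φ ⬝ᵥ A *ᵥ φ).re := h2
  exact le_of_mul_le_mul_left key hpos

/-! ### The hopping form is bounded by the number of bonds -/

/-- **`|Re⟨ψ, hamiltonian G t 0 ψ⟩| ≤ 2|t| P` for unit `ψ`** on a graph with at most `P` ordered bonds
(the tree's `norm_hoppingSum_le`). [folklore] -/
theorem abs_re_hopping_le_of_unit (G : SimpleGraph Λ) [DecidableRel G.Adj] (t : ℝ) {P : ℕ}
    (hP : #{pq : Λ × Λ | G.Adj pq.1 pq.2} ≤ P) {ψ : Fock (Orb Λ)} (hψ1 : star ψ ⬝ᵥ ψ = 1) :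
    |(star ψ ⬝ᵥ (hamiltonian G t 0 *ᵥ ψ)).re| ≤ 2 * |t| * P := by
  rw [ThermodynamicLimit.dotProduct_hamiltonian_mulVec, Complex.ofReal_zero, zero_mul, add_zero]
  set A : ℂ := ∑ x, ∑ y, ∑ σ : Fin 2, (if G.Adj x y then
      star (annihilation (orb x σ) *ᵥ ψ) ⬝ᵥ (annihilation (orb y σ) *ᵥ ψ) else 0) with hA
  have hAn : ‖A‖ ≤ 2 * P := ThermodynamicLimit.norm_hoppingSum_le G hψ1 hP
  calc |(-(t : ℂ) * A).re| ≤ ‖-(t : ℂ) * A‖ := Complex.abs_re_le_norm _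
    _ = |t| * ‖A‖ := by rw [norm_mul, norm_neg, Complex.norm_real, Real.norm_eq_abs]
    _ ≤ |t| * (2 * P) := mul_le_mul_of_nonneg_left hAn (abs_nonneg t)
    _ = 2 * |t| * P := by ring

/-- **`|Re⟨ψ, hamiltonian G t 0 ψ⟩| ≤ 2|t| P ‖ψ‖²` for every `ψ`** (homogeneous form). [folklore] -/
theorem abs_re_hopping_le (G : SimpleGraph Λ) [DecidableRel G.Adj] (t : ℝ) {P : ℕ}
    (hP : #{pq : Λ × Λ | G.Adj pq.1 pq.2} ≤ P) (ψ : Fock (Orb Λ)) :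
    |(star ψ ⬝ᵥ (hamiltonian G t 0 *ᵥ ψ)).re| ≤ 2 * |t| * P * (star ψ ⬝ᵥ ψ).re := by
  by_cases h0 : ψ = 0
  · subst h0
    simp
  obtain ⟨c, hc0, hc1⟩ := exists_smul_unit h0
  have hu := abs_re_hopping_le_of_unit G t hP hc1
  have hcc : star c * c = ((‖c‖ ^ 2 : ℝ) : ℂ) := by
    rw [Complex.star_def, Complex.conj_mul']
    push_cast
    rfl
  rw [mulVec_smul, star_smul, smul_dotProduct, dotProduct_smul, smul_smul, hcc, smul_eq_mul,
    Complex.re_ofReal_mul, abs_mul, abs_of_nonneg (by positivity : (0 : ℝ) ≤ ‖c‖ ^ 2)] at hu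
  rw [star_smul, smul_dotProduct, dotProduct_smul, smul_smul, hcc, smul_eq_mul] at hc1
  have h1 : ‖c‖ ^ 2 * (star ψ ⬝ᵥ ψ).re = 1 := by
    have := congrArg Complex.re hc1
    rwa [Complex.re_ofReal_mul, Complex.one_re] at this
  have hpos : 0 < ‖c‖ ^ 2 := by
    have : c ≠ 0 := hc0
    positivity
  have key : ‖c‖ ^ 2 * |(star ψ ⬝ᵥ (hamiltonian G t 0 *ᵥ ψ)).re| ≤
      ‖c‖ ^ 2 * (2 * |t| * P * (star ψ ⬝ᵥ ψ).re) :=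
    calc ‖c‖ ^ 2 * |(star ψ ⬝ᵥ (hamiltonian G t 0 *ᵥ ψ)).re| ≤ 2 * |t| * P := hu
      _ = 2 * |t| * P * (‖c‖ ^ 2 * (star ψ ⬝ᵥ ψ).re) := by rw [h1, mul_one]
      _ = ‖c‖ ^ 2 * (2 * |t| * P * (star ψ ⬝ᵥ ψ).re) := by ring
  exact le_of_mul_le_mul_left key hpos

/-! ### Bond counting on subgraphs of a bounded-degree graph -/

omit [LinearOrder Λ] in
/-- Degrees are monotone in the graph. [folklore] -/
theorem degree_le_of_le {G G' : SimpleGraph Λ} [DecidableRel G.Adj] [DecidableRel G'.Adj] (h : G' ≤ G)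
    (x : Λ) : #{y | G'.Adj x y} ≤ #{y | G.Adj x y} :=
  Finset.card_le_card (Finset.monotone_filter_right _ fun _ _ hy => h hy)

omit [LinearOrder Λ] in
/-- **Ordered bonds of a graph of degree `≤ Δ` number at most `Δ |Λ|`.** [folklore] -/
theorem card_adjPairs_le (G : SimpleGraph Λ) [DecidableRel G.Adj] {Δ : ℕ} (hΔ : ∀ x, #{y | G.Adj x y} ≤ Δ) :
    #{pq : Λ × Λ | G.Adj pq.1 pq.2} ≤ Δ * Fintype.card Λ := by
  classical
  have h1 : #{pq : Λ × Λ | G.Adj pq.1 pq.2} = ∑ x : Λ, #{y | G.Adj x y} := by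
    rw [Finset.card_filter, Fintype.sum_prod_type]
    refine Finset.sum_congr rfl fun x _ => ?_
    rw [Finset.card_filter]
  rw [h1]
  calc ∑ x : Λ, #{y | G.Adj x y} ≤ ∑ _x : Λ, Δ := Finset.sum_le_sum fun x _ => hΔ x
    _ = Δ * Fintype.card Λ := by rw [Finset.sum_const, Finset.card_univ, smul_eq_mul, mul_comm]

omit [LinearOrder Λ] in
/-- Ordered bonds of a subgraph of a graph of degree `≤ Δ` number at most `Δ |Λ|`. [folklore] -/
theorem card_adjPairs_le_of_le {G G' : SimpleGraph Λ} [DecidableRel G.Adj] [DecidableRel G'.Adj] (h : G' ≤ G)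
    {Δ : ℕ} (hΔ : ∀ x, #{y | G.Adj x y} ≤ Δ) : #{pq : Λ × Λ | G'.Adj pq.1 pq.2} ≤ Δ * Fintype.card Λ :=
  card_adjPairs_le G' fun x => (degree_le_of_le h x).trans (hΔ x)

/-! ### The torus: `L²` sites, degree `≤ 4` -/

/-- On a subgraph of the torus graph every site has at most four neighbours. [folklore] -/
theorem degree_le_four_of_le_torus {L : ℕ} [NeZero L] {G' : SimpleGraph (FermionTorus 2 L)} [DecidableRel G'.Adj]
    (h : G' ≤ fermionTorusGraph 2 L) (x : FermionTorus 2 L) : #{y | G'.Adj x y} ≤ 4 :=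
  (degree_le_of_le h x).trans (SourceGas.card_filter_fermionTorusGraph_adj_le x)

/-- A subgraph of the torus graph has at most `4L²` ordered bonds. [folklore] -/
theorem card_adjPairs_le_of_le_torus {L : ℕ} [NeZero L] {G' : SimpleGraph (FermionTorus 2 L)} [DecidableRel G'.Adj]
    (h : G' ≤ fermionTorusGraph 2 L) : #{pq : FermionTorus 2 L × FermionTorus 2 L | G'.Adj pq.1 pq.2} ≤ 4 * L ^ 2 := by
  rw [← Summit.HubbardSuperconductivity.NoGo.card_fermionTorus_two]
  exact card_adjPairs_le_of_le h fun x => SourceGas.card_filter_fermionTorusGraph_adj_le x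

/-- **The inter-plaquette hopping form is `O(L²)`**: for a subgraph `G'` of the torus graph,
`|Re⟨ψ, hamiltonian G' t 0 ψ⟩| ≤ 8|t| L² ‖ψ‖²`. [folklore] -/
theorem abs_re_hopping_le_torus {L : ℕ} [NeZero L] {G' : SimpleGraph (FermionTorus 2 L)} [DecidableRel G'.Adj]
    (h : G' ≤ fermionTorusGraph 2 L) (t : ℝ) (ψ : Fock (Orb (FermionTorus 2 L))) :
    |(star ψ ⬝ᵥ (hamiltonian G' t 0 *ᵥ ψ)).re| ≤ 8 * |t| * (L : ℝ) ^ 2 * (star ψ ⬝ᵥ ψ).re := by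
  have h1 := abs_re_hopping_le G' t (card_adjPairs_le_of_le_torus h) ψ
  refine h1.trans (le_of_eq ?_)
  push_cast
  ring

/-! ### Registered form -/

/-- **Registered sub-goal `pairTrialCeiling_breathingGroundState`** (closed form, as registered on the
crux item): the breathing Hamiltonian `hamiltonian G₁ a U + hamiltonian G₂ b 0` has a normalised ground
state in every joint sector `(2n, 0)`, `n ≤ |Λ|`. [folklore] -/
theorem pairTrialCeiling_breathingGroundState : ∀ {Λ : Type} [LinearOrder Λ] [Fintype Λ] (G₁ G₂ : SimpleGraph Λ) [DecidableRel G₁.Adj] [DecidableRel G₂.Adj] (a b U : ℝ) {n : ℕ}, n ≤ Fintype.card Λ → ∃ ψ : Fock (Orb Λ), star ψ ⬝ᵥ ψ = 1 ∧ IsGroundStateInSector (hamiltonian G₁ a U + hamiltonian G₂ b 0) (2 * n) 0 ψ :=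
  fun G₁ G₂ _ _ a b U _ hn => exists_unit_groundStateInSector_of_preservesSectors _
    (breathing_isHermitian G₁ G₂ a b U) (breathing_preservesSectors G₁ G₂ a b U) hn

end Summit.HubbardSuperconductivity.HubbardSuperconductivity.Theorems.CooperPairDMottWalk

end
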